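import Mathlib
import Summits.ValiantsHypothesis.ValiantsHypothesis.Theses.ProjectionRigidity
import Literature.Computability.AlgebraicComplexity.DetReprEquivalent
import Summits.ValiantsHypothesis.ValiantsHypothesis.Theorems.RigidMinimalRepsTorusBound
import Summits.ValiantsHypothesis.ValiantsHypothesis.Theorems.ProjectionStabilityOptStepStubGrenetProjection

/-!
# Line `toricfinite` (crux-strategist, alternative line) for crux `ProjectionRigidity.ProjOptimalUnique`
# (stmt-ValiantsHypothesis-16001, route-ValiantsHypothesis-ProjectionRigidity)

Crux, BY NAME: `Summit.ValiantsHypothesis.ValiantsHypothesis.Theses.ProjectionRigidity.ProjOptimalUnique` —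
for `n ≥ 3`, any two optimal VALIANT PROJECTIONS `A, B` (cells `X v` / `C c`, size `pdc(per_n)`,
`det = per_n`) are `DetReprEquivalent (permSymmetrySubst ℂ n)`-equivalent (the crux body is that relation
unfolded).

## The line: ORBITS FORCE TORUS, transferred to the projection model

The tree already PROVES, in the affine model (routes RigidMinimalReps / RigidityForcesSymmetry):
* `RigidMinimalRepsTorusBound.torusBound_proof` — a two-sided-torus-equivariant (exact lifts) affine
  representation of `per_n`, `n ≥ 3`, has size `≥ 2 ^ n - 1` (LR17 Thm 2.8 minus the Weyl group plus the
  right torus: regularity, one generic torus element, graded pigeonhole over `σ(S) = T`);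
* `RigidMinimalRepsOrbitsForceTorus.gauge_torusAct_of_finite` — on any torus-stable set of matrices covered
  by FINITELY MANY gauge classes `P · F_i · Q`, every member is gauge-equivalent to each of its torus
  translates (pigeonhole on `N!`-th roots; a divisible group has no proper finite-index subgroup), i.e. it is
  torus-equivariant with exact lifts.
In the affine model the finiteness input is false at plain minimality (Koszul moduli through Grenet_3 — the
same twists that refuted the affine OptimalUnique, negatives stmt-3735/3738).  In Valiant's model the twists
cannot act (this route's thesis), and the natural torus-stable enlargement of the pure projections is the set
of TORIC matrices sharing the pattern of a pure projection (cells `C c * X v` where the pure one has `X v`,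
constants elsewhere): one pattern per pure projection, each conjecturally rigid modulo gauge at the optimal
size (first-order verified at n = 3 for Grenet_3 and HI16 Example 10, zero cells free).  So:

* `stub_patternFinite` (S1, research; where the route's Target lives): for `n ≥ 3` and every optimal pure
  projection `A` of `per_n`, the TORIC PATTERN FAMILY of `A` (same variable labelling, multipliers and
  constants free, `det = per_n`) falls into finitely many `GL × GL` gauge classes.  Pattern-wise on purpose:
  the lead's signed non-Grenet `7 × 7` projection `T` of `per_3` (TORIC-T.txt) makes the set of ALL toric
  optimal-size projections of `per_3` infinite modulo gauge (by S2's own mechanism + tower rigidity at n = 3),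
  but `T`'s pattern carries no pure projection.
* `stub_equivariantOfPatternFinite` (S2, provable now, size M): at any size `m`, such finiteness makes `A`
  two-sided-torus-EQUIVARIANT with exact lifts — `gauge_torusAct_of_finite` with `M :=` the pattern family of
  `A` with `det = per_n` (stable under the normalised action `torusAct`, contains `A`), then
  `lifts_one/mul/inv` + `Subgroup.closure_induction` exactly as in `orbitsForceTorus_proof`.
* `stub_torusUnique` (S3, combinatorial rigidity, size XL): for `n ≥ 3`, any two two-sided-torus-equivariant
  PURE projections of size `2 ^ n - 1` with `det = per_n` are `DetReprEquivalent (permSymmetrySubst ℂ n)`.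
  At Grenet size the graded pigeonhole of `stub_torusBound` is tight: every level `s` carries exactly
  `C(n,s)` one-dimensional weight spaces whose types `(R,C)` form an EXACT COVER of `𝔖_n` by the events
  `σ(R) = C`; prefix polynomials are forced to be scalar multiples of sub-permanents `per(R,C)`; the tower of
  exact covers with the Laplace-type coefficient constraints between consecutive levels is Grenet's (rows in
  some order) or its transpose — VERIFIED BY COMPLETE ENUMERATION for `n = 3,…,7` (strategist folder
  `compute/towers_dfs.py`), conjectured for all `n`; the remaining multipliers are a coboundary on the
  hypercube (cycle space generated by squares = differences of permutation paths), hence diagonal gauge.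
  Printed cousin: Landsberg 2017 Thm 7.4.1.1 ("optimal and unique up to trivialities" for
  `Γ^E`-equivariant expressions).

COMPOSITION (kernel-checked below): optimal pure `A, B` ⟹ (S1+S2) both torus-equivariant ⟹ (tree
`torusBound_proof`) `2^n - 1 ≤ pdc(per_n)`, and `pdc(per_n) ≤ 2^n - 1` by the tree's
`stub_grenetProjection` (`Nat.sInf_le`) ⟹ `pdc(per_n) = 2^n - 1` ⟹ (S3) `A ~ B`.
Note: S1 + S2 + TorusBound already give the route's TARGET `2^n - 1 ≤ pdc(per_n)`; the line proves Target
and uniqueness from ONE finiteness statement (recorded for the tenure planner; `closes` is untouched).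

Why it dodges the registered line `birth`: `birth` needs an acyclic normal form (stub 1) and then must
re-derive Nisan's layering for cycle-cover determinants with constants of both signs (stub 2, "crux-sized by
construction", no grading available).  Here acyclicity AND the `(R,C)`-grading come for free from torus
equivariance (von zur Gathen regularity + eigenspaces of one generic lifted torus element — all inside the
proved `stub_torusBound`), uniqueness becomes finite combinatorics (S3), and the open input is FINITENESS
(S1), strictly weaker in kind than uniqueness and falsifiable pattern by pattern (first-order test run at
n = 3: Grenet_3 and HI16 Example 10 are rigid modulo GL inside their toric pattern families, zero cells free).

**Disproof used.** No `Disproof.lean` / `Negative/` exists for this crux (2026-08-17).  Negatives index: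
stmt-3735/3738 (affine twins) are refuted by a Koszul twist with two-variable cells — neither toric nor pure,
outside the hypotheses of S1–S3; stmt-5668/0340 unrelated.
-/

namespace Summit.ValiantsHypothesis.ValiantsHypothesis.Cruxes.ProjOptimalUnique.ToricFinite

open MvPolynomial Matrix
open Literature.Computability.AlgebraicComplexity
open Summit.ValiantsHypothesis.ValiantsHypothesis.Theses.ProjectionRigidity

set_option linter.dupNamespace false

noncomputable section

/-! ## The three stub statements (`Stmt` copies; the registered `stub_*` theorems below repeat them) -/

/-- STUB S1 — PATTERN FINITENESS at the optimal size (research stub; implies the route's Target via S2 and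
`TorusBound`).  For `n ≥ 3`, `m = pdc(per_n)` and every optimal PURE projection `A` (cells `X v` / `C c`,
`det A = per_n`), the TORIC PATTERN FAMILY of `A` — the `m × m` matrices `B` with `B i j = C c * X v` wherever
`A i j = X v` and `B i j` a constant wherever `A i j` is a constant, with `det B = per_n` — is covered by
finitely many gauge classes `P · F_i · Q`.  (Pattern-wise, NOT "all toric projections": the lead's signed
`7 × 7` projection `T` of `per_3` outside Grenet's class (evidence TORIC-T.txt, 2026-08-17) shows — via S2's
mechanism and the `n = 3` tower rigidity — that the set of ALL toric `7 × 7` projections of `per_3` meets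
infinitely many gauge classes; `T`'s pattern carries no pure projection, so it lies in no pure pattern family.) -/
def Stmt.stub_patternFinite : Prop :=
  ∀ n ≥ 3, ∀ m : ℕ,
    Literature.Computability.AlgebraicComplexity.detProjectionComplexity
        (Literature.Computability.AlgebraicComplexity.perPoly (Fin n) ℂ) = m →
    ∀ A : Matrix (Fin m) (Fin m) (MvPolynomial (Fin n × Fin n) ℂ),
      (∀ i j, (∃ v, A i j = MvPolynomial.X v) ∨ ∃ c, A i j = MvPolynomial.C c) →
      A.det = Literature.Computability.AlgebraicComplexity.perPoly (Fin n) ℂ →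
      ∃ (N : ℕ) (F : Fin N → Matrix (Fin m) (Fin m) (MvPolynomial (Fin n × Fin n) ℂ)),
        ∀ B : Matrix (Fin m) (Fin m) (MvPolynomial (Fin n × Fin n) ℂ),
          (∀ i j, (∃ (v : Fin n × Fin n) (c : ℂ), A i j = MvPolynomial.X v ∧ B i j = MvPolynomial.C c * MvPolynomial.X v) ∨
              ∃ c c' : ℂ, A i j = MvPolynomial.C c ∧ B i j = MvPolynomial.C c') →
          B.det = Literature.Computability.AlgebraicComplexity.perPoly (Fin n) ℂ →
          ∃ (i : Fin N) (P Q : Matrix.GeneralLinearGroup (Fin m) ℂ),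
            B = (P : Matrix (Fin m) (Fin m) ℂ).map MvPolynomial.C * F i *
              (Q : Matrix (Fin m) (Fin m) ℂ).map MvPolynomial.C

/-- STUB S2 — ORBITS FORCE TORUS, pattern-wise (provable now from the tree's
`RigidMinimalRepsOrbitsForceTorus.gauge_torusAct_of_finite`; size M).  At any size `m`: if the toric pattern
family of a pure projection `A` of `per_n` (`n ≥ 3`, `det A = per_n`) is covered by finitely many gauge
classes, then `A` is two-sided-torus-equivariant with exact lifts (`IsEquivariantDetRepr` for the subgroup
generated by `x_{kl} ↦ d_k e_l x_{kl}`, `d_k, e_l ≠ 0` — verbatim the subgroup of `RigidMinimalReps.TorusBound`):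
the family is stable under the normalised action `torusAct` and contains `A`, so the orbit argument applies. -/
def Stmt.stub_equivariantOfPatternFinite : Prop :=
  ∀ n ≥ 3, ∀ (m : ℕ) (A : Matrix (Fin m) (Fin m) (MvPolynomial (Fin n × Fin n) ℂ)),
    (∀ i j, (∃ v, A i j = MvPolynomial.X v) ∨ ∃ c, A i j = MvPolynomial.C c) →
    A.det = Literature.Computability.AlgebraicComplexity.perPoly (Fin n) ℂ →
    ∀ (N : ℕ) (F : Fin N → Matrix (Fin m) (Fin m) (MvPolynomial (Fin n × Fin n) ℂ)),
      (∀ B : Matrix (Fin m) (Fin m) (MvPolynomial (Fin n × Fin n) ℂ),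
          (∀ i j, (∃ (v : Fin n × Fin n) (c : ℂ), A i j = MvPolynomial.X v ∧ B i j = MvPolynomial.C c * MvPolynomial.X v) ∨
              ∃ c c' : ℂ, A i j = MvPolynomial.C c ∧ B i j = MvPolynomial.C c') →
          B.det = Literature.Computability.AlgebraicComplexity.perPoly (Fin n) ℂ →
          ∃ (i : Fin N) (P Q : Matrix.GeneralLinearGroup (Fin m) ℂ),
            B = (P : Matrix (Fin m) (Fin m) ℂ).map MvPolynomial.C * F i *
              (Q : Matrix (Fin m) (Fin m) ℂ).map MvPolynomial.C) →
      Literature.Computability.AlgebraicComplexity.IsEquivariantDetRepr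
        (Subgroup.closure {γ : Matrix.GeneralLinearGroup (Fin n × Fin n) ℂ | ∃ d e : Fin n → ℂ,
          (∀ i, d i ≠ 0) ∧ (∀ j, e j ≠ 0) ∧
          (γ : Matrix (Fin n × Fin n) (Fin n × Fin n) ℂ) = Matrix.diagonal (fun p => d p.1 * e p.2)})
        (Literature.Computability.AlgebraicComplexity.perPoly (Fin n) ℂ) A

/-- STUB S3 — TORUS UNIQUENESS AT GRENET SIZE (combinatorial rigidity; size XL).  For `n ≥ 3` and
`m = 2 ^ n - 1`, any two PURE projections of size `m` with `det = per_n` that are two-sided-torus-equivariant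
with exact lifts are `DetReprEquivalent (permSymmetrySubst ℂ n)`-equivalent (tight graded pigeonhole ⇒
exact-cover towers ⇒ Grenet's tower or its transpose — verified by complete enumeration for `n ≤ 7` — ⇒
diagonal gauge on the hypercube). -/
def Stmt.stub_torusUnique : Prop :=
  ∀ n ≥ 3, ∀ m : ℕ, m = 2 ^ n - 1 →
    ∀ A B : Matrix (Fin m) (Fin m) (MvPolynomial (Fin n × Fin n) ℂ),
      (∀ i j, (∃ v, A i j = MvPolynomial.X v) ∨ ∃ c, A i j = MvPolynomial.C c) →
      (∀ i j, (∃ v, B i j = MvPolynomial.X v) ∨ ∃ c, B i j = MvPolynomial.C c) →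
      A.det = Literature.Computability.AlgebraicComplexity.perPoly (Fin n) ℂ →
      B.det = Literature.Computability.AlgebraicComplexity.perPoly (Fin n) ℂ →
      Literature.Computability.AlgebraicComplexity.IsEquivariantDetRepr
        (Subgroup.closure {γ : Matrix.GeneralLinearGroup (Fin n × Fin n) ℂ | ∃ d e : Fin n → ℂ,
          (∀ i, d i ≠ 0) ∧ (∀ j, e j ≠ 0) ∧
          (γ : Matrix (Fin n × Fin n) (Fin n × Fin n) ℂ) = Matrix.diagonal (fun p => d p.1 * e p.2)})
        (Literature.Computability.AlgebraicComplexity.perPoly (Fin n) ℂ) A →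
      Literature.Computability.AlgebraicComplexity.IsEquivariantDetRepr
        (Subgroup.closure {γ : Matrix.GeneralLinearGroup (Fin n × Fin n) ℂ | ∃ d e : Fin n → ℂ,
          (∀ i, d i ≠ 0) ∧ (∀ j, e j ≠ 0) ∧
          (γ : Matrix (Fin n × Fin n) (Fin n × Fin n) ℂ) = Matrix.diagonal (fun p => d p.1 * e p.2)})
        (Literature.Computability.AlgebraicComplexity.perPoly (Fin n) ℂ) B →
      Literature.Computability.AlgebraicComplexity.DetReprEquivalent
        (Literature.Computability.AlgebraicComplexity.permSymmetrySubst ℂ n) A B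

/-! ## Registered stubs (the ONLY sorries of this file) -/

/-- Registered stub S1 = `Stmt.stub_patternFinite` (finitely many gauge classes in the toric pattern family of
every optimal pure projection of `per_n`). -/
theorem stub_patternFinite :
    ∀ n ≥ 3, ∀ m : ℕ,
      Literature.Computability.AlgebraicComplexity.detProjectionComplexity
          (Literature.Computability.AlgebraicComplexity.perPoly (Fin n) ℂ) = m →
      ∀ A : Matrix (Fin m) (Fin m) (MvPolynomial (Fin n × Fin n) ℂ),
        (∀ i j, (∃ v, A i j = MvPolynomial.X v) ∨ ∃ c, A i j = MvPolynomial.C c) →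
        A.det = Literature.Computability.AlgebraicComplexity.perPoly (Fin n) ℂ →
        ∃ (N : ℕ) (F : Fin N → Matrix (Fin m) (Fin m) (MvPolynomial (Fin n × Fin n) ℂ)),
          ∀ B : Matrix (Fin m) (Fin m) (MvPolynomial (Fin n × Fin n) ℂ),
            (∀ i j, (∃ (v : Fin n × Fin n) (c : ℂ), A i j = MvPolynomial.X v ∧ B i j = MvPolynomial.C c * MvPolynomial.X v) ∨
                ∃ c c' : ℂ, A i j = MvPolynomial.C c ∧ B i j = MvPolynomial.C c') →
            B.det = Literature.Computability.AlgebraicComplexity.perPoly (Fin n) ℂ →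
            ∃ (i : Fin N) (P Q : Matrix.GeneralLinearGroup (Fin m) ℂ),
              B = (P : Matrix (Fin m) (Fin m) ℂ).map MvPolynomial.C * F i *
                (Q : Matrix (Fin m) (Fin m) ℂ).map MvPolynomial.C := by
  sorry

/-- Registered stub S2 = `Stmt.stub_equivariantOfPatternFinite` (finitely many gauge classes in the toric
pattern family of a pure projection `A` of `per_n` ⇒ `A` is two-sided-torus-equivariant with exact lifts). -/
theorem stub_equivariantOfPatternFinite :
    ∀ n ≥ 3, ∀ (m : ℕ) (A : Matrix (Fin m) (Fin m) (MvPolynomial (Fin n × Fin n) ℂ)),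
      (∀ i j, (∃ v, A i j = MvPolynomial.X v) ∨ ∃ c, A i j = MvPolynomial.C c) →
      A.det = Literature.Computability.AlgebraicComplexity.perPoly (Fin n) ℂ →
      ∀ (N : ℕ) (F : Fin N → Matrix (Fin m) (Fin m) (MvPolynomial (Fin n × Fin n) ℂ)),
        (∀ B : Matrix (Fin m) (Fin m) (MvPolynomial (Fin n × Fin n) ℂ),
            (∀ i j, (∃ (v : Fin n × Fin n) (c : ℂ), A i j = MvPolynomial.X v ∧ B i j = MvPolynomial.C c * MvPolynomial.X v) ∨
                ∃ c c' : ℂ, A i j = MvPolynomial.C c ∧ B i j = MvPolynomial.C c') →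
            B.det = Literature.Computability.AlgebraicComplexity.perPoly (Fin n) ℂ →
            ∃ (i : Fin N) (P Q : Matrix.GeneralLinearGroup (Fin m) ℂ),
              B = (P : Matrix (Fin m) (Fin m) ℂ).map MvPolynomial.C * F i *
                (Q : Matrix (Fin m) (Fin m) ℂ).map MvPolynomial.C) →
        Literature.Computability.AlgebraicComplexity.IsEquivariantDetRepr
          (Subgroup.closure {γ : Matrix.GeneralLinearGroup (Fin n × Fin n) ℂ | ∃ d e : Fin n → ℂ,
            (∀ i, d i ≠ 0) ∧ (∀ j, e j ≠ 0) ∧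
            (γ : Matrix (Fin n × Fin n) (Fin n × Fin n) ℂ) = Matrix.diagonal (fun p => d p.1 * e p.2)})
          (Literature.Computability.AlgebraicComplexity.perPoly (Fin n) ℂ) A := by
  sorry

/-- Registered stub S3 = `Stmt.stub_torusUnique` (two-sided-torus-equivariant pure projections of size
`2 ^ n - 1` with `det = per_n` are equivalent up to gauge × `permSymmetrySubst` × transpose). -/
theorem stub_torusUnique :
    ∀ n ≥ 3, ∀ m : ℕ, m = 2 ^ n - 1 →
      ∀ A B : Matrix (Fin m) (Fin m) (MvPolynomial (Fin n × Fin n) ℂ),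
        (∀ i j, (∃ v, A i j = MvPolynomial.X v) ∨ ∃ c, A i j = MvPolynomial.C c) →
        (∀ i j, (∃ v, B i j = MvPolynomial.X v) ∨ ∃ c, B i j = MvPolynomial.C c) →
        A.det = Literature.Computability.AlgebraicComplexity.perPoly (Fin n) ℂ →
        B.det = Literature.Computability.AlgebraicComplexity.perPoly (Fin n) ℂ →
        Literature.Computability.AlgebraicComplexity.IsEquivariantDetRepr
          (Subgroup.closure {γ : Matrix.GeneralLinearGroup (Fin n × Fin n) ℂ | ∃ d e : Fin n → ℂ,
            (∀ i, d i ≠ 0) ∧ (∀ j, e j ≠ 0) ∧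
            (γ : Matrix (Fin n × Fin n) (Fin n × Fin n) ℂ) = Matrix.diagonal (fun p => d p.1 * e p.2)})
          (Literature.Computability.AlgebraicComplexity.perPoly (Fin n) ℂ) A →
        Literature.Computability.AlgebraicComplexity.IsEquivariantDetRepr
          (Subgroup.closure {γ : Matrix.GeneralLinearGroup (Fin n × Fin n) ℂ | ∃ d e : Fin n → ℂ,
            (∀ i, d i ≠ 0) ∧ (∀ j, e j ≠ 0) ∧
            (γ : Matrix (Fin n × Fin n) (Fin n × Fin n) ℂ) = Matrix.diagonal (fun p => d p.1 * e p.2)})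
          (Literature.Computability.AlgebraicComplexity.perPoly (Fin n) ℂ) B →
        Literature.Computability.AlgebraicComplexity.DetReprEquivalent
          (Literature.Computability.AlgebraicComplexity.permSymmetrySubst ℂ n) A B := by
  sorry

/-! ## Sorry-free glue -/

/-- Grenet's projection bounds Valiant's measure from above: `pdc(per_n) ≤ 2 ^ n - 1` (`n ≥ 1`), from the
tree's `stub_grenetProjection : IsDetProjection per_n (2 ^ n - 1)` and `Nat.sInf_le`. [cite: Grenet2011, Thm. 1] -/
theorem pdc_le_grenet {n : ℕ} (hn : 1 ≤ n) :
    Literature.Computability.AlgebraicComplexity.detProjectionComplexity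
        (Literature.Computability.AlgebraicComplexity.perPoly (Fin n) ℂ) ≤ 2 ^ n - 1 := by
  unfold Literature.Computability.AlgebraicComplexity.detProjectionComplexity
  exact Nat.sInf_le
    (Summit.ValiantsHypothesis.ValiantsHypothesis.Theorems.ProjectionStabilityOptStep.GrenetProjection.stub_grenetProjection
      n hn)

/-- The tree's two-sided `TorusBound` (route RigidMinimalReps, stmt-5114, PROVED:
`RigidMinimalRepsTorusBound.torusBound_proof`), unfolded: a two-sided-torus-equivariant affine
representation of `per_n`, `n ≥ 3`, has size `≥ 2 ^ n - 1`. [cite: LandsbergRessayre2017, Thm. 2.8] -/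
theorem torusBound_unfolded :
    ∀ n : ℕ, 3 ≤ n → ∀ (m : ℕ) (A : Matrix (Fin m) (Fin m) (MvPolynomial (Fin n × Fin n) ℂ)),
      Literature.Computability.AlgebraicComplexity.IsEquivariantDetRepr
        (Subgroup.closure {γ : Matrix.GeneralLinearGroup (Fin n × Fin n) ℂ | ∃ d e : Fin n → ℂ,
          (∀ i, d i ≠ 0) ∧ (∀ j, e j ≠ 0) ∧
          (γ : Matrix (Fin n × Fin n) (Fin n × Fin n) ℂ) = Matrix.diagonal (fun p => d p.1 * e p.2)})
        (Literature.Computability.AlgebraicComplexity.perPoly (Fin n) ℂ) A → 2 ^ n - 1 ≤ m :=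
  Summit.ValiantsHypothesis.ValiantsHypothesis.Theorems.RigidMinimalRepsTorusBound.torusBound_proof

/-! ## The composition (kernel-checked, sorry-free) -/

/-- **The crux from the three stubs.**  Given optimal pure projections `A, B` of `per_n` (`n ≥ 3`):
S1 gives finitely many gauge classes of optimal-size toric projections, S2 makes `A` and `B`
two-sided-torus-equivariant, the tree's `TorusBound` then gives `2 ^ n - 1 ≤ pdc(per_n)` while Grenet's
projection gives `pdc(per_n) ≤ 2 ^ n - 1`, so the size is `2 ^ n - 1` and S3 applies; the crux conclusion is
`DetReprEquivalent (permSymmetrySubst ℂ n) A B` unfolded. -/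
theorem ProjOptimalUnique_of :
    Stmt.stub_patternFinite → Stmt.stub_equivariantOfPatternFinite → Stmt.stub_torusUnique →
      Summit.ValiantsHypothesis.ValiantsHypothesis.Theses.ProjectionRigidity.ProjOptimalUnique := by
  intro h₁ h₂ h₃
  unfold Stmt.stub_patternFinite at h₁
  unfold Stmt.stub_equivariantOfPatternFinite at h₂
  unfold Stmt.stub_torusUnique at h₃
  unfold Summit.ValiantsHypothesis.ValiantsHypothesis.Theses.ProjectionRigidity.ProjOptimalUnique
  intro n hn A B hA hB hdA hdB
  -- S1: finitely many gauge classes in the toric pattern families of `A` and of `B`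
  obtain ⟨N, F, hF⟩ := h₁ n hn _ rfl A hA hdA
  obtain ⟨N', F', hF'⟩ := h₁ n hn _ rfl B hB hdB
  -- S2: both optimal projections are two-sided-torus-equivariant
  have heA := h₂ n hn _ A hA hdA N F hF
  have heB := h₂ n hn _ B hB hdB N' F' hF'
  -- the size is Grenet's: TorusBound (tree) and Grenet's projection (tree)
  have hge : 2 ^ n - 1 ≤ Literature.Computability.AlgebraicComplexity.detProjectionComplexity
      (Literature.Computability.AlgebraicComplexity.perPoly (Fin n) ℂ) :=
    torusBound_unfolded n hn _ A heA
  have hle := pdc_le_grenet (n := n) (by omega)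
  have hsize : Literature.Computability.AlgebraicComplexity.detProjectionComplexity
      (Literature.Computability.AlgebraicComplexity.perPoly (Fin n) ℂ) = 2 ^ n - 1 :=
    le_antisymm hle hge
  -- S3 at size 2^n - 1
  exact h₃ n hn _ hsize A B hA hB hdA hdB heA heB

/-- THE SKELETON: the crux, modulo exactly the three registered stubs (compile-checks that the `Stmt`
copies and the stub statements agree). -/
theorem ProjOptimalUnique_proof :
    Summit.ValiantsHypothesis.ValiantsHypothesis.Theses.ProjectionRigidity.ProjOptimalUnique :=
  ProjOptimalUnique_of stub_patternFinite stub_equivariantOfPatternFinite stub_torusUnique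

end

end Summit.ValiantsHypothesis.ValiantsHypothesis.Cruxes.ProjOptimalUnique.ToricFinite
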